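import Literature.Probability.Percolation.ProdBernoulliRusso
import Summits.CriticalPhenomena.PercolationContinuityZ3.Theorems.AdditiveGluing.Negative.CertSoundness
import Summits.CriticalPhenomena.PercolationContinuityZ3.Theorems.PercNearOneGluingNoHeavyLowerTailTwoCopyFibre

/-!
# Crux `NoHeavyLowerTail` (stmt-CriticalPhenomena-4575), certificate programme for the `|A| = 5` one-cut rung:
# bit-mask configurations of a weighted graph and the expansion of every probability over them

Link between bond percolation `prodBernoulli w` on `Fin n` with ARBITRARY weights
`w : Sym2 (Fin n) → [0,1]` and the measure-free two-copy algebra of `…TwoCopyFibre`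
(`TwoCopy.wt`, `TwoCopy.ex`).  For an edge list `es : List (Fin n × Fin n)` (`m = es.length`) and a bit
mask `c`, `pick es c` is the sub-list of edges whose index bit is set and `Eset (pick es c)` the
corresponding edge set (`AdditiveGluing.Negative.Cert.Eset`).  Main statements:

* `sum_powerset_Eset_eq_sum_range` — reindexing `(Eset es).powerset ≃ {c < 2^m}` for lists with
  distinct unordered pairs;
* `prod_Eset_eq_wt` — the cylinder weight of `Eset (pick es c)` is `TwoCopy.wt m (wN w es) c`,
  `wN w es i = w (mkE es[i])`;
* `prodBernoulli_real_eq_ex` — **for every event `D` determined by `Eset es`: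
  `P_w(D) = E_w[1_D] = Σ_{c < 2^m} 1[Eset (pick es c) ∈ D] · wt(c)`** (from
  `RussoPath.prodBernoulli_real_eq_sum_powerset`);
* `determinedBy_allPairs_of_openGraph` — events read off the open graph are determined by the list
  `allPairs n` of all vertex pairs `i < j` (loops never matter), so the above applies to every
  connection event with `es = allPairs n` and NO hypothesis on `w`.

Nothing here asserts anything about the crux.
-/

namespace Summit.CriticalPhenomena.PercolationContinuityZ3.Theorems.TwoCopy

open Finset MeasureTheory
open Literature.Probability.Percolation Literature.Probability.LatticeModels
open Summit.CriticalPhenomena.PercolationContinuityZ3.Theorems.AdditiveGluing.Negative.Cert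

/-! ## Sub-configurations by bit mask -/

/-- The sub-list of `l` selected by the bit mask `c` (element `i` is kept iff bit `i` of `c` is set). [this work] -/
def pick {α : Type*} : List α → ℕ → List α
  | [], _ => []
  | a :: l, c => if c.testBit 0 then a :: pick l (c / 2) else pick l (c / 2)

/-- `pick` on a cons with bit `0` set. [this work] -/
theorem pick_cons_of_testBit {α : Type*} (a : α) (l : List α) {c : ℕ} (h : c.testBit 0 = true) :
    pick (a :: l) c = a :: pick l (c / 2) := by simp [pick, h]

/-- `pick` on a cons with bit `0` unset. [this work] -/
theorem pick_cons_of_not_testBit {α : Type*} (a : α) (l : List α) {c : ℕ} (h : c.testBit 0 = false) :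
    pick (a :: l) c = pick l (c / 2) := by simp [pick, h]

/-- `pick` selects a sub-list. [this work] -/
theorem pick_sublist {α : Type*} : ∀ (l : List α) (c : ℕ), (pick l c).Sublist l
  | [], _ => by simp [pick]
  | a :: l, c => by
    by_cases h : c.testBit 0 = true
    · rw [pick_cons_of_testBit a l h]; exact (pick_sublist l (c / 2)).cons_cons a
    · rw [pick_cons_of_not_testBit a l (Bool.eq_false_iff.2 h)]; exact (pick_sublist l (c / 2)).cons a

/-- Membership of the `i`-th unordered pair in the edge set of `pick es c` is bit `i` of `c`
(lists with distinct unordered pairs). [this work] -/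
theorem mkE_getElem_mem_Eset_pick {n : ℕ} : ∀ (es : List (Fin n × Fin n)), (es.map mkE).Nodup →
    ∀ (c i : ℕ) (hi : i < es.length), (mkE (es[i]) ∈ Eset (pick es c) ↔ c.testBit i = true)
  | [], _, c, i, hi => by simp at hi
  | e :: l, hnd, c, i, hi => by
    rw [List.map_cons, List.nodup_cons] at hnd
    have he : mkE e ∉ Eset l := by simpa [Eset] using hnd.1
    have hsub : ∀ c', Eset (pick l c') ⊆ Eset l := fun c' => by
      intro x hx
      simp only [Eset, List.mem_toFinset, List.mem_map] at hx ⊢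
      obtain ⟨p, hp, rfl⟩ := hx
      exact ⟨p, (pick_sublist l c').subset hp, rfl⟩
    cases i with
    | zero =>
      simp only [List.getElem_cons_zero]
      cases hb : c.testBit 0 with
      | true => rw [pick_cons_of_testBit e l hb, Eset_cons]; simp
      | false =>
        rw [pick_cons_of_not_testBit e l hb]
        simp only [Bool.false_eq_true, iff_false]
        exact fun hm => he (hsub _ hm)
    | succ i =>
      have hi' : i < l.length := by simpa using hi
      simp only [List.getElem_cons_succ, Nat.testBit_add_one]
      rw [← mkE_getElem_mem_Eset_pick l hnd.2 (c / 2) i hi']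
      have hne : mkE (l[i]) ≠ mkE e := by
        intro h
        apply he
        rw [← h]
        simp only [Eset, List.mem_toFinset, List.mem_map]
        exact ⟨l[i], List.getElem_mem hi', rfl⟩
      cases hb : c.testBit 0 with
      | true =>
        rw [pick_cons_of_testBit e l hb, Eset_cons, mem_insert]
        exact ⟨fun h' => h'.resolve_left hne, fun h' => Or.inr h'⟩
      | false => rw [pick_cons_of_not_testBit e l hb]

/-! ## Reindexing the powerset by bit masks -/

/-- Splitting a sum over `range (2 k)` into even and odd indices. [folklore] -/
theorem sum_range_two_mul {β : Type*} [AddCommMonoid β] (k : ℕ) (f : ℕ → β) :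
    ∑ c ∈ range (2 * k), f c = ∑ c ∈ range k, (f (2 * c) + f (2 * c + 1)) := by
  induction k with
  | zero => simp
  | succ k ih =>
    rw [show 2 * (k + 1) = 2 * k + 1 + 1 by ring, sum_range_succ, sum_range_succ, ih, sum_range_succ, add_assoc]

/-- **Reindexing**: for a list of pairs with distinct unordered images, summing a function of the edge
set over the powerset of `Eset es` is summing it over the bit masks `c < 2^m` through `Eset (pick es c)`. [this work] -/
theorem sum_powerset_Eset_eq_sum_range {n : ℕ} {β : Type*} [AddCommMonoid β] :
    ∀ (es : List (Fin n × Fin n)), (es.map mkE).Nodup → ∀ (F : Finset (Sym2 (Fin n)) → β),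
      ∑ S ∈ (Eset es).powerset, F S = ∑ c ∈ range (2 ^ es.length), F (Eset (pick es c))
  | [], _, F => by simp [Eset_nil, pick]
  | e :: l, hnd, F => by
    rw [List.map_cons, List.nodup_cons] at hnd
    have he : mkE e ∉ Eset l := by simpa [Eset] using hnd.1
    rw [Eset_cons, powerset_insert, sum_union, List.length_cons, pow_succ, mul_comm, sum_range_two_mul]
    · rw [sum_image]
      · rw [sum_powerset_Eset_eq_sum_range l hnd.2 F,
          sum_powerset_Eset_eq_sum_range l hnd.2 (fun S => F (insert (mkE e) S)), ← sum_add_distrib]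
        refine sum_congr rfl fun c _ => ?_
        have h0 : (2 * c).testBit 0 = false := by simp [Nat.mul_mod_right]
        have h1 : (2 * c + 1).testBit 0 = true := by simp
        have d0 : 2 * c / 2 = c := by omega
        have d1 : (2 * c + 1) / 2 = c := by omega
        rw [pick_cons_of_not_testBit e l h0, pick_cons_of_testBit e l h1, d0, d1, Eset_cons]
      · intro S hS T hT hST
        rw [mem_coe, mem_powerset] at hS hT
        have hS' : mkE e ∉ S := fun h => he (hS h)
        have hT' : mkE e ∉ T := fun h => he (hT h)
        rw [← erase_insert hS', hST, erase_insert hT']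
    · rw [disjoint_left]
      intro S hS hS2
      rw [mem_powerset] at hS
      obtain ⟨T, _, rfl⟩ := mem_image.1 hS2
      exact he (hS (mem_insert_self _ _))

/-! ## The cylinder weight is `TwoCopy.wt` -/

/-- Coordinate weights of an edge list, as a function of the edge INDEX (junk `0` beyond the list). [this work] -/
noncomputable def wN {n : ℕ} (w : Sym2 (Fin n) → unitInterval) (es : List (Fin n × Fin n)) (i : ℕ) : ℝ :=
  if h : i < es.length then (w (mkE (es[i])) : ℝ) else 0

/-- `wN` takes values in `[0, 1]`. [this work] -/
theorem wN_mem {n : ℕ} (w : Sym2 (Fin n) → unitInterval) (es : List (Fin n × Fin n)) (i : ℕ) :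
    0 ≤ wN w es i ∧ wN w es i ≤ 1 := by
  unfold wN
  split_ifs
  · exact ⟨(w _).2.1, (w _).2.2⟩
  · exact ⟨le_rfl, zero_le_one⟩

/-- The cylinder weight of the edge set `Eset (pick es c)` inside `Eset es` is `wt m (wN w es) c`. [this work] -/
theorem prod_Eset_eq_wt {n : ℕ} (w : Sym2 (Fin n) → unitInterval) (es : List (Fin n × Fin n))
    (hnd : (es.map mkE).Nodup) (c : ℕ) :
    ∏ i ∈ Eset es, (if i ∈ Eset (pick es c) then (w i : ℝ) else 1 - (w i : ℝ)) = wt es.length (wN w es) c := by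
  unfold wt
  -- `Eset es` is the image of `Fin m` under `i ↦ mkE es[i]`, injectively
  have himg : Eset es = univ.image fun i : Fin es.length => mkE (es[(i : ℕ)]) := by
    ext x
    simp only [Eset, List.mem_toFinset, List.mem_map, mem_image, mem_univ, true_and]
    constructor
    · rintro ⟨p, hp, rfl⟩
      obtain ⟨i, hi, rfl⟩ := List.getElem_of_mem hp
      exact ⟨⟨i, hi⟩, rfl⟩
    · rintro ⟨i, rfl⟩
      exact ⟨es[(i : ℕ)], List.getElem_mem i.2, rfl⟩
  have hinj : Function.Injective fun i : Fin es.length => mkE (es[(i : ℕ)]) := by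
    intro i j hij
    have hnd' := (List.nodup_iff_injective_getElem).1 hnd
    have : (⟨i, by simp⟩ : Fin (es.map mkE).length) = ⟨j, by simp⟩ := by
      apply hnd'
      simpa using hij
    exact Fin.ext (by simpa using congrArg Fin.val this)
  rw [himg, prod_image fun i _ j _ h => hinj h, prod_range]
  refine prod_congr rfl fun i _ => ?_
  have hi : (i : ℕ) < es.length := i.2
  simp only [mkE_getElem_mem_Eset_pick es hnd c i hi, wN, hi, dite_true]

/-! ## The expansion of a probability over bit-mask configurations -/

/-- **`P_w(D) = E_w[1_D]`** for every event `D` determined by the edge set of `es` (distinct unordered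
pairs): the probability is the `wt`-weighted count of the masks `c < 2^m` with `Eset (pick es c) ∈ D`. [this work] -/
theorem prodBernoulli_real_eq_ex {n : ℕ} (w : Sym2 (Fin n) → unitInterval) (es : List (Fin n × Fin n))
    (hnd : (es.map mkE).Nodup) (D : Set (Set (Sym2 (Fin n)))) [DecidablePred fun S : Finset (Sym2 (Fin n)) => (↑S : Set _) ∈ D]
    (hD : DeterminedBy D (↑(Eset es) : Set (Sym2 (Fin n)))) :
    (prodBernoulli w).real D =
      ex es.length (wN w es) (fun c => if (↑(Eset (pick es c)) : Set (Sym2 (Fin n))) ∈ D then 1 else 0) := by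
  classical
  rw [RussoPath.prodBernoulli_real_eq_sum_powerset hD w, sum_powerset_Eset_eq_sum_range es hnd]
  unfold ex
  refine sum_congr rfl fun c _ => ?_
  by_cases h : (↑(Eset (pick es c)) : Set (Sym2 (Fin n))) ∈ D
  · simp only [h, if_true, one_mul]; exact prod_Eset_eq_wt w es hnd c
  · simp only [h, if_false, zero_mul]

/-- The total mass: `E_w[1] = 1`. [this work] -/
theorem ex_one {n : ℕ} (w : Sym2 (Fin n) → unitInterval) (es : List (Fin n × Fin n)) (hnd : (es.map mkE).Nodup) :
    ex es.length (wN w es) (fun _ => 1) = 1 := by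
  classical
  have hdet : DeterminedBy (Set.univ : Set (Set (Sym2 (Fin n)))) (↑(Eset es) : Set (Sym2 (Fin n))) := by
    rw [determinedBy_iff]; intros; simp
  have h := prodBernoulli_real_eq_ex w es hnd Set.univ hdet
  simp only [Set.mem_univ, if_true, probReal_univ] at h
  exact h.symm

/-! ## Events read off the open graph are determined by `allPairs n` -/

/-- If two configurations agree on all pairs `s(i, j)` with `i < j` then they have the same open graph. [this work] -/
theorem openGraph_eq_of_inter_allPairs {n : ℕ} {ω ω' : Set (Sym2 (Fin n))}
    (h : ω ∩ ↑(Eset (allPairs n)) = ω' ∩ ↑(Eset (allPairs n))) : openGraph ω = openGraph ω' := by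
  have key : ∀ x y : Fin n, x ≠ y → (s(x, y) ∈ ω ↔ s(x, y) ∈ ω') := by
    intro x y hxy
    have hmem : s(x, y) ∈ (↑(Eset (allPairs n)) : Set (Sym2 (Fin n))) := by
      rw [mem_coe, mem_Eset_iff]
      rcases lt_or_gt_of_ne hxy with hlt | hlt
      · exact ⟨(x, y), (mem_allPairs _).2 hlt, Or.inl rfl⟩
      · exact ⟨(y, x), (mem_allPairs _).2 hlt, Or.inr rfl⟩
    constructor
    · intro hx
      have : s(x, y) ∈ ω' ∩ ↑(Eset (allPairs n)) := h ▸ ⟨hx, hmem⟩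
      exact this.1
    · intro hx
      have : s(x, y) ∈ ω ∩ ↑(Eset (allPairs n)) := h.symm ▸ ⟨hx, hmem⟩
      exact this.1
  ext x y
  simp only [openGraph_adj]
  constructor
  · rintro ⟨hm, hne⟩; exact ⟨(key x y hne).1 hm, hne⟩
  · rintro ⟨hm, hne⟩; exact ⟨(key x y hne).2 hm, hne⟩

/-- **Events read off the open graph are determined by `Eset (allPairs n)`.** [this work] -/
theorem determinedBy_allPairs_of_openGraph {n : ℕ} {D : Set (Set (Sym2 (Fin n)))}
    (hD : ∀ ω ω' : Set (Sym2 (Fin n)), openGraph ω = openGraph ω' → (ω ∈ D ↔ ω' ∈ D)) :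
    DeterminedBy D (↑(Eset (allPairs n)) : Set (Sym2 (Fin n))) := by
  rw [determinedBy_iff]
  intro ω ω' h
  exact hD ω ω' (openGraph_eq_of_inter_allPairs h)

/-- `allPairs n` has distinct unordered pairs. [this work] -/
theorem nodup_map_mkE_allPairs (n : ℕ) : ((allPairs n).map mkE).Nodup :=
  nodup_map_mk_of_sublist (List.Sublist.refl _)

end Summit.CriticalPhenomena.PercolationContinuityZ3.Theorems.TwoCopy
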